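import Literature.NumberTheory.LFunctions.ZetaScrewThm18Proofs
import Mathlib.Analysis.Matrix.Order
import Mathlib.LinearAlgebra.Matrix.SchurComplement
import Mathlib.Algebra.Polynomial.Roots
import HarnessLib

/-!
# Suzuki's Theorem 1.8 in strict-determinant form (Stieltjes' criterion): proofs

LINE 1 — LABEL: RH-EQUIVALENT·PRINTED criterion (Suzuki2023 Thm 1.8), proved here AS AN EQUIVALENCE
in the CORRECTED determinant reading `RH ⟺ det Δ_n > 0 ∧ det Δ_n^{(1)} > 0 (∀ n ≥ 0)`
(`riemannHypothesis_iff_det_zetaScrewHankel_pos`) and in positive-definite form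
(`riemannHypothesis_iff_posDef_zetaScrewHankel`); the new RH-FREE door is
`riemannHypothesis_of_det_zetaScrewHankel_pos`. bears_on: LADDER-RH B-C/B-P (COLUMN 6 DBR; the moments
`μ_n` of COLUMN 1's `Ψ`). WHAT THIS IS NOT: not progress toward RH — nobody has shown these determinants
positive; the theorem fixes WHICH inequalities on the moment determinants are equivalent to RH;
nothing here bears on the truth of RH.

Proof-only companion (D-0014; no definitions, no named facts) of `ZetaScrewGrowthMoments.lean`
(`Suzuki2023_thm18`, `zetaScrewHankel`, `zetaScrewHankelShift`) and `ZetaScrewThm18Proofs.lean`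
(`riemannHypothesis_of_posSemidef_zetaScrewHankel`), following M. Suzuki, J. Lond. Math. Soc. (2) 108
(2023) = arXiv:2206.03682 [Suzuki2023], Thm 1.8 (pp. 3–4) and §7.3 (p. 17).

## Statement and its relation to the printed Thm 1.8 (erratum record of the cell, E23)

Printed: "the RH is true if and only if `det Δ_n ≥ 0` and `det Δ_n^{(1)} ≥ 0` for all `n ∈ ℤ_{>0}`".
The `⟸` step of §7.3 ("the sign conditions make `{μ_n}` a Stieltjes moment sequence [KrNu77]")
needs positivity of the Hankel FORMS; Stieltjes' determinant criterion delivers that from STRICT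
positivity of ALL leading minors `det Δ_n > 0`, `det Δ_n^{(1)} > 0`, `n ≥ 0` (Sylvester's criterion),
not from weak inequalities on the leading minors of order `≥ 2`. Proved here:

  `RiemannHypothesis ↔ ∀ n, 0 < det Δ_n ∧ 0 < det Δ_n^{(1)}`.

`⟸`: Sylvester's criterion (`ZetaScrewThm18.posDef_zetaScrewHankel_of_det_pos`; the leading
`(k+1) × (k+1)` block of `Δ_n` is `Δ_k`) and the positive-semidefinite door of the sibling file.
`⟹`: under RH `Ψ > 0` on `(0, ∞)` (Thm 1.7, tree `ZetaScrewThm17.zetaScrew_pos_of_RH`), so the Hankel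
forms `∫₀^∞ 4^{-1}e^{-t/2}Ψ(t) t^s q(t)² dt` are `> 0` for every non-zero polynomial `q` (a non-zero
polynomial is non-zero on an open subset of `(0,∞)`): the matrices are positive DEFINITE and
`det > 0` (`Matrix.PosDef.det_pos`). The typed verbatim fact `Suzuki2023_thm18` (weak inequalities,
`n ≥ 1`) is not touched.

## Contents

* `ZetaScrewThm18.posDef_of_leadingMinors_pos` (private) — Sylvester's criterion for real symmetric
  `(n+1) × (n+1)` matrices: all leading principal minors `> 0` ⟹ positive definite (induction via the
  Schur complement of the leading block: Mathlib `Matrix.PosDef.fromBlocks₁₁`, `Matrix.det_fromBlocks₁₁`,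
  `Matrix.PosSemidef.posDef_iff_det_ne_zero`).
* `ZetaScrewThm18.zetaScrewHankel_submatrix`, `…Shift_submatrix` — leading blocks of `Δ_n`, `Δ_n^{(1)}`.
* `ZetaScrewThm18.hankel_quadForm_pos_of_RH`, `posDef_zetaScrewHankel_of_RH`,
  `det_zetaScrewHankel_pos_of_RH` — strictness under RH.
* `riemannHypothesis_of_det_zetaScrewHankel_pos`, `riemannHypothesis_iff_det_zetaScrewHankel_pos`,
  `riemannHypothesis_iff_posDef_zetaScrewHankel`.

## References

* M. Suzuki, J. Lond. Math. Soc. (2) 108 (2023), no. 4, 1448–1487; arXiv:2206.03682, Thm 1.8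
  (pp. 3–4), §7.3 (p. 17). [Suzuki2023]
* (Background, not used in the proofs: Stieltjes' determinant criterion for the Stieltjes moment
  problem and Sylvester's criterion for positive definiteness.)
-/

noncomputable section

open Complex Filter Topology Finset MeasureTheory
open scoped Real Nat Matrix

namespace Literature.NumberTheory.LFunctions

namespace ZetaScrewThm18

/-! ### A. Sylvester's criterion: positive leading principal minors ⟹ positive definite -/

/-- Leading principal submatrices compose. [folklore] -/
private theorem submatrix_castLE_castLE {m n k : ℕ} (H : Matrix (Fin m) (Fin m) ℝ) (h₁ : n ≤ m)
    (h₂ : k ≤ n) :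
    (H.submatrix (Fin.castLE h₁) (Fin.castLE h₁)).submatrix (Fin.castLE h₂) (Fin.castLE h₂) =
      H.submatrix (Fin.castLE (h₂.trans h₁)) (Fin.castLE (h₂.trans h₁)) := by
  ext i j
  rfl

/-- The full leading principal submatrix is the matrix. [folklore] -/
private theorem submatrix_castLE_self {m : ℕ} (H : Matrix (Fin m) (Fin m) ℝ) (h : m ≤ m) :
    H.submatrix (Fin.castLE h) (Fin.castLE h) = H := by
  ext i j
  rfl

/-- A `1 × 1` real matrix with non-negative entry is positive semidefinite. [folklore] -/
private theorem posSemidef_fin_one {S : Matrix (Fin 1) (Fin 1) ℝ} (h : 0 ≤ S 0 0) : S.PosSemidef := by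
  refine Matrix.PosSemidef.of_dotProduct_mulVec_nonneg
    (Matrix.IsHermitian.ext fun i j ↦ by fin_cases i; fin_cases j; simp) fun x ↦ ?_
  simp only [dotProduct, Matrix.mulVec, Fin.sum_univ_one, Pi.star_apply, star_trivial,
    Fin.isValue]
  have : x 0 * (S 0 0 * x 0) = S 0 0 * (x 0) ^ 2 := by ring
  rw [this]
  positivity

/-- A `1 × 1` real matrix with positive entry is positive definite. [folklore] -/
private theorem posDef_fin_one {S : Matrix (Fin 1) (Fin 1) ℝ} (h : 0 < S 0 0) : S.PosDef := by
  refine Matrix.PosDef.of_dotProduct_mulVec_pos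
    (Matrix.IsHermitian.ext fun i j ↦ by fin_cases i; fin_cases j; simp) fun x hx ↦ ?_
  simp only [dotProduct, Matrix.mulVec, Fin.sum_univ_one, Pi.star_apply, star_trivial,
    Fin.isValue]
  have hx0 : x 0 ≠ 0 := by
    intro h0
    apply hx
    funext i
    fin_cases i
    exact h0
  have : x 0 * (S 0 0 * x 0) = S 0 0 * (x 0) ^ 2 := by ring
  rw [this]
  positivity

/-- **Sylvester's criterion** (real symmetric matrices): if all leading principal minors of a real
symmetric `(n+1) × (n+1)` matrix are positive, the matrix is positive definite (induction on `n` via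
the Schur complement of the leading `n × n` block, Mathlib `Matrix.PosDef.fromBlocks₁₁` and
`Matrix.det_fromBlocks₁₁`). [folklore] -/
private theorem posDef_of_leadingMinors_pos :
    ∀ (n : ℕ) (H : Matrix (Fin (n + 1)) (Fin (n + 1)) ℝ), H.IsHermitian →
      (∀ (k : ℕ) (hk : k + 1 ≤ n + 1), 0 < (H.submatrix (Fin.castLE hk) (Fin.castLE hk)).det) →
      H.PosDef := by
  intro n
  induction n with
  | zero =>
    intro H _ hdet
    have h := hdet 0 le_rfl
    rw [submatrix_castLE_self, Matrix.det_fin_one] at h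
    exact posDef_fin_one h
  | succ n ih =>
    intro H hH hdet
    -- the leading block `A`
    have h1 : n + 1 ≤ n + 1 + 1 := by omega
    set A : Matrix (Fin (n + 1)) (Fin (n + 1)) ℝ := H.submatrix (Fin.castLE h1) (Fin.castLE h1) with hA
    have hAherm : A.IsHermitian := hH.submatrix _
    have hApd : A.PosDef := by
      refine ih A hAherm fun k hk ↦ ?_
      rw [hA, submatrix_castLE_castLE]
      exact hdet k (by omega)
    have hAdet : 0 < A.det := hApd.det_pos
    -- block decomposition along `Fin (n+1) ⊕ Fin 1 ≃ Fin (n+2)`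
    set e : Fin (n + 1) ⊕ Fin 1 ≃ Fin (n + 1 + 1) := finSumFinEquiv with he
    set M : Matrix (Fin (n + 1) ⊕ Fin 1) (Fin (n + 1) ⊕ Fin 1) ℝ := H.submatrix e e with hM
    have hMdet : M.det = H.det := Matrix.det_submatrix_equiv_self e H
    have hHdet : 0 < H.det := by
      have h := hdet (n + 1) le_rfl
      rwa [submatrix_castLE_self] at h
    have hM11 : M.toBlocks₁₁ = A := by
      ext i j
      simp only [Matrix.toBlocks₁₁, Matrix.of_apply, hM, Matrix.submatrix_apply, he,
        finSumFinEquiv_apply_left, hA]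
      rfl
    have hM21 : M.toBlocks₂₁ = (M.toBlocks₁₂)ᴴ := by
      ext i j
      simp only [Matrix.toBlocks₂₁, Matrix.toBlocks₁₂, Matrix.of_apply, Matrix.conjTranspose_apply,
        star_trivial, hM, Matrix.submatrix_apply]
      exact (hH.apply _ _).symm.trans (by simp)
    have hMblocks : M = Matrix.fromBlocks A M.toBlocks₁₂ (M.toBlocks₁₂)ᴴ M.toBlocks₂₂ := by
      rw [← hM11, ← hM21, Matrix.fromBlocks_toBlocks]
    -- Schur complement
    letI : Invertible A := hApd.isUnit.invertible
    set S : Matrix (Fin 1) (Fin 1) ℝ := M.toBlocks₂₂ - (M.toBlocks₁₂)ᴴ * A⁻¹ * M.toBlocks₁₂ with hS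
    have hdetM : M.det = A.det * S.det := by
      rw [hMblocks, Matrix.det_fromBlocks₁₁, Matrix.invOf_eq_nonsing_inv]
    have hSdet : 0 < S.det := by
      have h : 0 < A.det * S.det := by rw [← hdetM, hMdet]; exact hHdet
      exact pos_of_mul_pos_right h hAdet.le
    have hSpsd : S.PosSemidef := by
      refine posSemidef_fin_one ?_
      rw [Matrix.det_fin_one] at hSdet
      exact hSdet.le
    have hMpsd : M.PosSemidef := by
      rw [hMblocks]
      exact (Matrix.PosDef.fromBlocks₁₁ _ _ hApd).2 hSpsd
    have hMpd : M.PosDef := hMpsd.posDef_iff_det_ne_zero.2 (by rw [hMdet]; exact hHdet.ne')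
    -- back to `H`
    have hHM : H = M.submatrix e.symm e.symm := by
      rw [hM, Matrix.submatrix_submatrix, Equiv.self_comp_symm, Matrix.submatrix_id_id]
    rw [hHM]
    exact hMpd.submatrix e.symm.injective

/-! ### B. The leading principal submatrices of the Hankel matrices -/

/-- The leading `(k+1) × (k+1)` block of `Δ_n` is `Δ_k`. [cite: Suzuki2023, Thm 1.8 (Hankel matrices)] -/
theorem zetaScrewHankel_submatrix {k n : ℕ} (hk : k + 1 ≤ n + 1) :
    (zetaScrewHankel n).submatrix (Fin.castLE hk) (Fin.castLE hk) = zetaScrewHankel k := by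
  ext i j
  simp [zetaScrewHankel_apply]

/-- The leading `(k+1) × (k+1)` block of `Δ_n^{(1)}` is `Δ_k^{(1)}`. [cite: Suzuki2023, Thm 1.8 (Hankel matrices)] -/
theorem zetaScrewHankelShift_submatrix {k n : ℕ} (hk : k + 1 ≤ n + 1) :
    (zetaScrewHankelShift n).submatrix (Fin.castLE hk) (Fin.castLE hk) = zetaScrewHankelShift k := by
  ext i j
  simp [zetaScrewHankelShift_apply]

/-- **Strict determinants ⟹ positive definite Hankel matrices** (Sylvester's criterion applied to
`Δ_n`, `Δ_n^{(1)}`): if `det Δ_k > 0` and `det Δ_k^{(1)} > 0` for all `k`, every `Δ_n` and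
`Δ_n^{(1)}` is positive definite. [cite: Suzuki2023, Thm 1.8 / §7.3 ([KrNu77]: Stieltjes' determinant criterion)] -/
theorem posDef_zetaScrewHankel_of_det_pos
    (h : ∀ n : ℕ, 0 < (zetaScrewHankel n).det ∧ 0 < (zetaScrewHankelShift n).det) (n : ℕ) :
    (zetaScrewHankel n).PosDef ∧ (zetaScrewHankelShift n).PosDef := by
  constructor
  · refine posDef_of_leadingMinors_pos n _ (ZetaScrewGrowth.isHermitian_zetaScrewHankel n) fun k hk ↦ ?_
    rw [zetaScrewHankel_submatrix hk]
    exact (h k).1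
  · refine posDef_of_leadingMinors_pos n _ (ZetaScrewGrowth.isHermitian_zetaScrewHankelShift n)
      fun k hk ↦ ?_
    rw [zetaScrewHankelShift_submatrix hk]
    exact (h k).2

/-! ### C. Under RH the Hankel matrices are positive definite -/

/-- A non-zero coefficient vector gives a polynomial function that does not vanish at some `t > 0`
(a non-zero polynomial has finitely many roots). [folklore] -/
private theorem exists_pos_eval_ne_zero {n : ℕ} {x : Fin (n + 1) → ℝ} (hx : x ≠ 0) :
    ∃ t : ℝ, 0 < t ∧ ∑ i : Fin (n + 1), x i * t ^ (i : ℕ) ≠ 0 := by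
  classical
  set p : Polynomial ℝ := ∑ i : Fin (n + 1), Polynomial.monomial (i : ℕ) (x i) with hp
  have hp_eval : ∀ t, p.eval t = ∑ i : Fin (n + 1), x i * t ^ (i : ℕ) := by
    intro t
    simp [hp, Polynomial.eval_finsetSum, Polynomial.eval_monomial]
  have hp0 : p ≠ 0 := by
    obtain ⟨i, hi⟩ := Function.ne_iff.1 hx
    intro h0
    have hc : p.coeff (i : ℕ) = x i := by
      simp only [hp, Polynomial.finsetSum_coeff, Polynomial.coeff_monomial]
      rw [Finset.sum_eq_single i]
      · simp
      · intro j _ hji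
        rw [if_neg]
        exact fun h ↦ hji (Fin.ext h)
      · simp
    rw [h0, Polynomial.coeff_zero] at hc
    exact hi (by simpa using hc.symm)
  by_contra hall
  push Not at hall
  apply hp0
  refine Polynomial.eq_zero_of_infinite_isRoot p ?_
  refine Set.Infinite.mono (fun t (ht : t ∈ Set.Ioi (0 : ℝ)) ↦ ?_) (Set.Ioi_infinite 0)
  simp only [Set.mem_setOf_eq, Polynomial.IsRoot.def, hp_eval]
  exact hall t ht

/-- RH-CONSEQUENCE. Under RH the Hankel forms are positive DEFINITE: `Ψ > 0` on `(0, ∞)` (Thm 1.7,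
tree `ZetaScrewThm17.zetaScrew_pos_of_RH`) and a non-zero polynomial is non-zero on an open subset of
`(0, ∞)`. [cite: Suzuki2023, Thm 1.7 and §7.3 (proof of Thm 1.8)] -/
theorem hankel_quadForm_pos_of_RH (hRH : RiemannHypothesis) (n s : ℕ) {x : Fin (n + 1) → ℝ}
    (hx : x ≠ 0) :
    0 < ∑ i : Fin (n + 1), ∑ j : Fin (n + 1), x i * zetaScrewMoment ((i : ℕ) + (j : ℕ) + s) * x j := by
  rw [ZetaScrewGrowth.hankel_quadForm_eq]
  set f : ℝ → ℝ := fun t ↦ 4⁻¹ * Real.exp (-(t / 2)) * zetaScrew t * t ^ s *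
    (∑ i : Fin (n + 1), x i * t ^ (i : ℕ)) ^ 2 with hf
  -- integrability on `(0, ∞)`
  have hint : IntegrableOn f (Set.Ioi 0) := by
    have hexpand : f = fun t ↦ ∑ i : Fin (n + 1), ∑ j : Fin (n + 1), x i * x j *
        (4⁻¹ * Real.exp (-(t / 2)) * zetaScrew t * t ^ ((i : ℕ) + (j : ℕ) + s)) := by
      funext t
      simp only [hf]
      rw [sq, Finset.sum_mul_sum, Finset.mul_sum]
      refine Finset.sum_congr rfl fun i _ ↦ ?_
      rw [Finset.mul_sum]
      refine Finset.sum_congr rfl fun j _ ↦ ?_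
      rw [pow_add, pow_add]
      ring
    rw [hexpand]
    refine integrable_finsetSum _ fun i _ ↦ integrable_finsetSum _ fun j _ ↦ ?_
    exact (integrableOn_zetaScrewMoment_integrand _).const_mul _
  have hcont : Continuous f := by
    have := continuous_zetaScrew
    simp only [hf]
    fun_prop
  have hnn : ∀ t, 0 < t → 0 ≤ f t := by
    intro t ht
    have hΨ := ZetaScrewThm17.zetaScrew_nonneg_of_RH hRH t
    simp only [hf]
    positivity
  obtain ⟨t₀, ht₀, hq⟩ := exists_pos_eval_ne_zero hx
  have hf₀ : 0 < f t₀ := by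
    have hΨ := ZetaScrewThm17.zetaScrew_pos_of_RH hRH ht₀.ne'
    have hq2 : 0 < (∑ i : Fin (n + 1), x i * t₀ ^ (i : ℕ)) ^ 2 := by positivity
    simp only [hf]
    positivity
  have hU : IsOpen ({t | 0 < f t} ∩ Set.Ioi 0) := (isOpen_lt continuous_const hcont).inter isOpen_Ioi
  have hUpos : 0 < volume ({t | 0 < f t} ∩ Set.Ioi 0) := hU.measure_pos volume ⟨t₀, hf₀, ht₀⟩
  rw [setIntegral_pos_iff_support_of_nonneg_ae
    ((ae_restrict_mem measurableSet_Ioi).mono fun t ht ↦ hnn t ht) hint]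
  exact hUpos.trans_le (measure_mono fun t ht ↦ ⟨ht.1.ne', ht.2⟩)

/-- RH-CONSEQUENCE. Under RH, `Δ_n` and `Δ_n^{(1)}` are positive definite.
[cite: Suzuki2023, §7.3 (proof of Thm 1.8)] -/
theorem posDef_zetaScrewHankel_of_RH (hRH : RiemannHypothesis) (n : ℕ) :
    (zetaScrewHankel n).PosDef ∧ (zetaScrewHankelShift n).PosDef := by
  constructor
  · refine Matrix.PosDef.of_dotProduct_mulVec_pos (ZetaScrewGrowth.isHermitian_zetaScrewHankel n)
      fun x hx ↦ ?_
    have h := hankel_quadForm_pos_of_RH hRH n 0 hx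
    simp only [add_zero] at h
    have key : dotProduct (star x) ((zetaScrewHankel n).mulVec x) =
        ∑ i : Fin (n + 1), ∑ j : Fin (n + 1), x i * zetaScrewMoment ((i : ℕ) + (j : ℕ)) * x j := by
      simp only [dotProduct, Matrix.mulVec, Pi.star_apply, star_trivial, zetaScrewHankel,
        Matrix.of_apply, Finset.mul_sum]
      refine Finset.sum_congr rfl fun i _ ↦ Finset.sum_congr rfl fun j _ ↦ ?_
      ring
    rw [key]
    exact h
  · refine Matrix.PosDef.of_dotProduct_mulVec_pos (ZetaScrewGrowth.isHermitian_zetaScrewHankelShift n)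
      fun x hx ↦ ?_
    have h := hankel_quadForm_pos_of_RH hRH n 1 hx
    have key : dotProduct (star x) ((zetaScrewHankelShift n).mulVec x) =
        ∑ i : Fin (n + 1), ∑ j : Fin (n + 1), x i * zetaScrewMoment ((i : ℕ) + (j : ℕ) + 1) * x j := by
      simp only [dotProduct, Matrix.mulVec, Pi.star_apply, star_trivial, zetaScrewHankelShift,
        Matrix.of_apply, Finset.mul_sum]
      refine Finset.sum_congr rfl fun i _ ↦ Finset.sum_congr rfl fun j _ ↦ ?_
      ring
    rw [key]
    exact h

/-- RH-CONSEQUENCE. Under RH all Hankel determinants are STRICTLY positive: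
`det Δ_n > 0`, `det Δ_n^{(1)} > 0` (the moment sequence of the positive measure
`4^{-1}e^{-t/2}Ψ(t)dt` with infinite support). [cite: Suzuki2023, Thm 1.8 and §7.3] -/
theorem det_zetaScrewHankel_pos_of_RH (hRH : RiemannHypothesis) (n : ℕ) :
    0 < (zetaScrewHankel n).det ∧ 0 < (zetaScrewHankelShift n).det :=
  ⟨(posDef_zetaScrewHankel_of_RH hRH n).1.det_pos, (posDef_zetaScrewHankel_of_RH hRH n).2.det_pos⟩

end ZetaScrewThm18

/-- RH-EQUIVALENT criterion, sufficiency half in DETERMINANT form (line 1): **if `det Δ_n > 0` and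
`det Δ_n^{(1)} > 0` for all `n ≥ 0`, the Riemann hypothesis holds** — Sylvester's criterion makes
all `Δ_n`, `Δ_n^{(1)}` positive definite, and `riemannHypothesis_of_posSemidef_zetaScrewHankel`
applies. This is the `⟸` half of Suzuki2023 Thm 1.8 with the printed weak inequalities
`det ≥ 0` (`n ≥ 1`) replaced by STRICT ones for all `n ≥ 0` (Stieltjes' determinant criterion;
with weak inequalities on the leading minors alone the step "[KrNu77]" of §7.3 does not apply).
WHAT THIS IS NOT: nobody has shown these determinants positive; the theorem fixes WHICH
inequalities would prove RH. [cite: Suzuki2023, Thm 1.8, pp. 3–4 and §7.3, p. 17] -/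
theorem riemannHypothesis_of_det_zetaScrewHankel_pos
    (h : ∀ n : ℕ, 0 < (zetaScrewHankel n).det ∧ 0 < (zetaScrewHankelShift n).det) :
    RiemannHypothesis :=
  riemannHypothesis_of_posSemidef_zetaScrewHankel fun n ↦
    ⟨(ZetaScrewThm18.posDef_zetaScrewHankel_of_det_pos h n).1.posSemidef,
      (ZetaScrewThm18.posDef_zetaScrewHankel_of_det_pos h n).2.posSemidef⟩

/-- RH-EQUIVALENT (line 1). **Suzuki2023 Thm 1.8 in STRICT determinant form, both directions:**
`RH ⟺ det Δ_n > 0 ∧ det Δ_n^{(1)} > 0` for all `n ≥ 0` — the corrected reading of the printed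
"`det Δ_n ≥ 0` and `det Δ_n^{(1)} ≥ 0` for all `n ∈ ℤ_{>0}`" (under RH the determinants are in fact
strictly positive; conversely strict positivity of ALL leading minors, including `μ_0 = det Δ_0` and
`μ_1 = det Δ_0^{(1)}`, is what makes the Hankel forms positive definite). WHAT THIS IS NOT: a criterion,
not a proof of RH; nothing here bears on the truth of RH. [cite: Suzuki2023, Thm 1.8, pp. 3–4 and §7.3, p. 17] -/
theorem riemannHypothesis_iff_det_zetaScrewHankel_pos :
    RiemannHypothesis ↔ ∀ n : ℕ, 0 < (zetaScrewHankel n).det ∧ 0 < (zetaScrewHankelShift n).det :=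
  ⟨fun hRH n ↦ ZetaScrewThm18.det_zetaScrewHankel_pos_of_RH hRH n,
    riemannHypothesis_of_det_zetaScrewHankel_pos⟩

/-- RH-EQUIVALENT (line 1). Positive-DEFINITE form of Thm 1.8: `RH ⟺` all `Δ_n`, `Δ_n^{(1)}` are
positive definite. [cite: Suzuki2023, Thm 1.8, pp. 3–4 and §7.3, p. 17] -/
theorem riemannHypothesis_iff_posDef_zetaScrewHankel :
    RiemannHypothesis ↔ ∀ n : ℕ, (zetaScrewHankel n).PosDef ∧ (zetaScrewHankelShift n).PosDef :=
  ⟨fun hRH n ↦ ZetaScrewThm18.posDef_zetaScrewHankel_of_RH hRH n, fun h ↦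
    riemannHypothesis_of_posSemidef_zetaScrewHankel fun n ↦ ⟨(h n).1.posSemidef, (h n).2.posSemidef⟩⟩

end Literature.NumberTheory.LFunctions
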